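import Summits.CriticalPhenomena.SAWScalingLimit.Theorems.SAWDefectDecoherenceBoundaryClosureRPickEngineTwoArm
import Summits.CriticalPhenomena.SAWScalingLimit.Theorems.SAWDefectDecoherenceBoundaryClosureRPickEngineNoEssential
import Summits.CriticalPhenomena.SAWScalingLimit.Theorems.SAWDefectDecoherenceBoundaryClosureRPickEngineRootOrder
import Summits.CriticalPhenomena.SAWScalingLimit.Theorems.SAWDefectDecoherenceBoundaryClosureRPickEngineFlatValue
import Literature.Probability.RandomPlanarGeometry.PlanarDomains

/-!
# Pick engine, STAGE 2 glue (line `pick-half-plane`, stub `stub_pickEngine`)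

Support file for crux `BoundaryClosureR` (stmt-CriticalPhenomena-14004), line `pick-half-plane`,
stub `stub_pickEngine : DevelopingMapExact → HalfPlaneBounds → FlatMassLaws → LocalL1Bound →
DefectDecoherence → MassRatio → PickCupLimits` (skeleton r3).  This file composes the five landed
stage-2 helpers (`…PickEngineTwoArm`, `…NoEssential`, `…RootOrder`, `…FlatValue`; `…Remark` serves
stage 1) into the export contract `IsPickCupLimit D ρ x r g` of the line (§2 of the skeleton,
unfolded here: holomorphy of `g` on the carrier, blow-up `g (z - x)^{5/4} → κ ≠ 0` at the pinned
root, nonzero limits of `g` at every other flat boundary point), for `g = α⁻¹ h'` where `h` is the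
limit of the normalised developing maps.  Every analytic input is an explicit hypothesis, so the
remaining debt of the stub is visible:

* STAGE 1 (not here): existence of the subsequential limit `h` holomorphic on `D.carrier` with
  `h' = α g` and the weak convergence of the functionals (`InteriorLimits`, from DefectDecoherence +
  MassRatio + HalfPlaneBounds (i) + LocalL1Bound by discrete Harnack / Weyl);
* (I1) ARM REGULARITY at the root `x`: `h` continuous on the punctured closed upper half-disc
  `({im ≥ im x} ∩ B(x, r₀)) ∖ {x}` with the east ray mapped into the line `p + e^{iθ}ℝ` and the west
  ray into `p + e^{i(θ-π/4)}ℝ` (the two straight arms of `DevelopingMapExact` (E4) in the limit);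
* (I2) ROOT WEDGE: `-M ≤ re (ω̄ h)` on that punctured closed half-disc (HalfPlaneBounds (ii) in the
  limit, `ω = -e^{i(5/8)W_b}` rigid, `|ω| = 1`) with the compatibility `re (ω e^{-iθ}) > 0`,
  `re (ω e^{-iθ}) > im (ω e^{-iθ})` (for the rigid data `θ = π/8 - (3/8)W_b`, `W_b ∈ π + 2πℤ`, one has
  `ω e^{-iθ} = e^{-iπ/8}`);
* (I3) DIVERGENCE: `h` is unbounded at `x` from inside the carrier (FlatMassLaws (b));
* (I4) FLAT REGULARITY: at every flat point `y ≠ x` (gate and root piece) `h` is continuous up to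
  the diameter, maps it into a line, and its normal component grows at least linearly
  (FlatMassLaws (a), uniform in the scale, in the limit).

Main results: `nhdsWithin_carrier_eq` (the pinned filter identity), `wedge_compat_of_rigid`
(the rigid data satisfy (I2)'s compatibility), `pickEngine_stage2` (registered sub-goal).  No new definitions.
References: Ahlfors (1979) Ch. 4; Conway (1978) IX.1.1; Pommerenke (1992) §3.1.
-/

noncomputable section

open scoped Topology ComplexConjugate
open Filter Set Metric Complex
open Literature.Probability.RandomPlanarGeometry

namespace Summit.CriticalPhenomena.SAWScalingLimit.Theorems.PickHalfPlane.Engine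

/-- **The pinned filter identity.** If inside `ball y s` the set `Ω` is exactly the open upper
half-disc above `y`, then approaching `y` inside `Ω` is approaching `y` inside
`{im z > im y} ∩ ball y s`. [folklore] -/
theorem nhdsWithin_carrier_eq {Ω : Set ℂ} {y : ℂ} {s : ℝ} (hs : 0 < s)
    (hflat : Ω ∩ ball y s = {z : ℂ | y.im < z.im} ∩ ball y s) :
    𝓝[Ω] y = 𝓝[{z : ℂ | y.im < z.im} ∩ ball y s] y := by
  rw [← nhdsWithin_inter_of_mem' (mem_nhdsWithin_of_mem_nhds (ball_mem_nhds y hs) : ball y s ∈ 𝓝[Ω] y),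
    hflat]

/-- Local flatness propagates to smaller concentric balls and to balls around other points of the
flat piece: if `Ω ∩ ball c R = {im > im c} ∩ ball c R`, `y.im = c.im` and `ball y s ⊆ ball c R`,
then `Ω ∩ ball y s = {im > im y} ∩ ball y s`. [folklore] -/
theorem flat_of_subset {Ω : Set ℂ} {c y : ℂ} {R s : ℝ}
    (hflat : Ω ∩ ball c R = {z : ℂ | c.im < z.im} ∩ ball c R) (hy : y.im = c.im)
    (hsub : ball y s ⊆ ball c R) :
    Ω ∩ ball y s = {z : ℂ | y.im < z.im} ∩ ball y s := by
  ext z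
  constructor
  · rintro ⟨hzΩ, hz⟩
    have : z ∈ Ω ∩ ball c R := ⟨hzΩ, hsub hz⟩
    rw [hflat] at this
    exact ⟨by rw [mem_setOf_eq, hy]; exact this.1, hz⟩
  · rintro ⟨hzim, hz⟩
    have : z ∈ {z : ℂ | c.im < z.im} ∩ ball c R := ⟨by rw [mem_setOf_eq, ← hy]; exact hzim, hsub hz⟩
    rw [← hflat] at this
    exact ⟨this.1, hz⟩

/-- **The rigid data satisfy the compatibility of (I2).** For the explicit wedge direction
`ω = -e^{i(5/8)W}` of `HalfPlaneBounds` (ii) and the east-arm phase `θ = π/8 - (3/8)W` of the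
straight arms ((E2)+(E4): east winding `-π`, `F(b) = -Z(b) e^{i(3/8)W}`), with `W = W_b ∈ π + 2πℤ`
(a walk from a floor root to a floor edge turns by an odd multiple of `π`), one has
`ω e^{-iθ} = e^{-iπ/8}`: so `|ω| = 1`, `re (ω e^{-iθ}) = cos (π/8) > 0` and
`im (ω e^{-iθ}) = -sin (π/8) < re (ω e^{-iθ})`, i.e. the hypotheses `hωn`, `hω₁`, `hω₂` of
`pickEngine_stage2` below (`b` east of `a`: `W = -π`, `ω = e^{3iπ/8}`, `θ = π/2`). [folklore] -/
theorem wedge_compat_of_rigid :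
    ∀ (W : ℝ) (k : ℤ), W = Real.pi + 2 * Real.pi * k →
      ‖-Complex.exp (Complex.I * (5 / 8 : ℂ) * (W : ℂ))‖ = 1 ∧
      0 < (-Complex.exp (Complex.I * (5 / 8 : ℂ) * (W : ℂ)) *
        Complex.exp (-(((Real.pi / 8 - 3 / 8 * W : ℝ) : ℂ) * Complex.I))).re ∧
      (-Complex.exp (Complex.I * (5 / 8 : ℂ) * (W : ℂ)) *
        Complex.exp (-(((Real.pi / 8 - 3 / 8 * W : ℝ) : ℂ) * Complex.I))).im <
      (-Complex.exp (Complex.I * (5 / 8 : ℂ) * (W : ℂ)) *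
        Complex.exp (-(((Real.pi / 8 - 3 / 8 * W : ℝ) : ℂ) * Complex.I))).re := by
  intro W k hW
  have hprod : -Complex.exp (Complex.I * (5 / 8 : ℂ) * (W : ℂ)) *
      Complex.exp (-(((Real.pi / 8 - 3 / 8 * W : ℝ) : ℂ) * Complex.I)) =
      Complex.exp (((-(Real.pi / 8) : ℝ) : ℂ) * Complex.I) := by
    rw [neg_mul, ← Complex.exp_add]
    have : Complex.I * (5 / 8 : ℂ) * (W : ℂ) + -(((Real.pi / 8 - 3 / 8 * W : ℝ) : ℂ) * Complex.I) =
        ((-(Real.pi / 8) : ℝ) : ℂ) * Complex.I + (k : ℂ) * (2 * Real.pi * Complex.I) +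
          Real.pi * Complex.I := by
      rw [hW]; push_cast; ring
    rw [this, Complex.exp_add, Complex.exp_add, Complex.exp_int_mul_two_pi_mul_I,
      Complex.exp_pi_mul_I]
    ring
  have hre : (Complex.exp (((-(Real.pi / 8) : ℝ) : ℂ) * Complex.I)).re = Real.cos (Real.pi / 8) := by
    rw [Complex.exp_ofReal_mul_I_re, Real.cos_neg]
  have him : (Complex.exp (((-(Real.pi / 8) : ℝ) : ℂ) * Complex.I)).im = -Real.sin (Real.pi / 8) := by
    rw [Complex.exp_ofReal_mul_I_im, Real.sin_neg]
  have hcos : 0 < Real.cos (Real.pi / 8) :=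
    Real.cos_pos_of_mem_Ioo ⟨by linarith [Real.pi_pos], by linarith [Real.pi_pos]⟩
  have hsin : 0 < Real.sin (Real.pi / 8) :=
    Real.sin_pos_of_pos_of_lt_pi (by linarith [Real.pi_pos]) (by linarith [Real.pi_pos])
  refine ⟨?_, ?_, ?_⟩
  · rw [norm_neg, show Complex.I * (5 / 8 : ℂ) * (W : ℂ) = ((5 / 8 * W : ℝ) : ℂ) * Complex.I by
      push_cast; ring, Complex.norm_exp_ofReal_mul_I]
  · rw [hprod, hre]; exact hcos
  · rw [hprod, hre, him]; linarith

/-- **STAGE 2 of the Pick engine (registered sub-goal `pickEngine_stage2` of stub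
`stub_pickEngine`).** For a Dobrushin carrier pinned at the normaliser `D.pt 1` (radius `ρ`) and at
the root `x` (radius `r`), a function `h` holomorphic on the carrier with `h' = α g` there
(`α ≠ 0`), satisfying (I1) arm regularity and (I2) the root wedge on a punctured closed half-disc
of radius `r₀ ≤ r` at `x`, (I3) unboundedness at `x` inside the carrier, and (I4) flat regularity
with linear normal growth at every flat point `y ≠ x`, the density `g` satisfies the line's export
contract `IsPickCupLimit D ρ x r g` (unfolded): `g` is holomorphic on the carrier,
`g (z - x)^{5/4} → κ ≠ 0` at the root inside the carrier, and `g → w ≠ 0` at every other flat point.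
Composition: TwoArm → NoEssential (Casorati–Weierstrass) → RootOrder at the root, FlatValue
(Schwarz reflection) at the flat points, and the pinned filter identity. [folklore] -/
theorem pickEngine_stage2 :
    ∀ (D : DobrushinDomain) (ρ : ℝ) (x : ℂ) (r r₀ : ℝ) (h g : ℂ → ℂ) (α p ω : ℂ) (θ M : ℝ),
      0 < ρ → D.carrier ∩ Metric.ball (D.pt 1) ρ =
        {z : ℂ | (D.pt 1).im < z.im} ∩ Metric.ball (D.pt 1) ρ →
      0 < r → D.carrier ∩ Metric.ball x r = {z : ℂ | x.im < z.im} ∩ Metric.ball x r →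
      0 < r₀ → r₀ ≤ r → α ≠ 0 →
      DifferentiableOn ℂ h D.carrier → (∀ z ∈ D.carrier, deriv h z = α * g z) →
      ContinuousOn h (({z : ℂ | x.im ≤ z.im} ∩ Metric.ball x r₀) \ {x}) →
      (∀ z ∈ Metric.ball x r₀, z.im = x.im → x.re < z.re →
        ∃ s : ℝ, h z = p + Complex.exp ((θ : ℂ) * Complex.I) * s) →
      (∀ z ∈ Metric.ball x r₀, z.im = x.im → z.re < x.re →
        ∃ s : ℝ, h z = p + Complex.exp (((θ - Real.pi / 4 : ℝ) : ℂ) * Complex.I) * s) →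
      ‖ω‖ = 1 → 0 < (ω * Complex.exp (-((θ : ℂ) * Complex.I))).re →
      (ω * Complex.exp (-((θ : ℂ) * Complex.I))).im < (ω * Complex.exp (-((θ : ℂ) * Complex.I))).re →
      (∀ z ∈ ({z : ℂ | x.im ≤ z.im} ∩ Metric.ball x r₀) \ {x}, -M ≤ ((starRingEnd ℂ) ω * h z).re) →
      (∀ A : ℝ, ∃ᶠ z in 𝓝[D.carrier] x, A ≤ ‖h z‖) →
      (∀ y ∈ ({z : ℂ | z.im = (D.pt 1).im} ∩ Metric.ball (D.pt 1) ρ) ∪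
          ({z : ℂ | z.im = x.im} ∩ Metric.ball x r), y ≠ x →
        ∃ ρ' : ℝ, 0 < ρ' ∧ ∃ θ' : ℝ, ∃ p' : ℂ, ∃ c' : ℝ, 0 < c' ∧
          ContinuousOn h ({z : ℂ | y.im ≤ z.im} ∩ Metric.ball y ρ') ∧
          (∀ z ∈ Metric.ball y ρ', z.im = y.im →
            (Complex.exp (-((θ' : ℂ) * Complex.I)) * (h z - p')).im = 0) ∧
          (∀ t : ℝ, 0 < t → t < ρ' → c' * t ≤
            |(Complex.exp (-((θ' : ℂ) * Complex.I)) * (h (y + (t : ℂ) * Complex.I) - p')).im|)) →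
      DifferentiableOn ℂ g D.carrier ∧
      (∃ κ : ℂ, κ ≠ 0 ∧
        Tendsto (fun z => g z * (z - x) ^ ((5 : ℂ) / 4)) (𝓝[D.carrier] x) (𝓝 κ)) ∧
      (∀ y ∈ ({z : ℂ | z.im = (D.pt 1).im} ∩ Metric.ball (D.pt 1) ρ) ∪
          ({z : ℂ | z.im = x.im} ∩ Metric.ball x r), y ≠ x →
        ∃ w : ℂ, w ≠ 0 ∧ Tendsto g (𝓝[D.carrier] y) (𝓝 w)) := by
  intro D ρ x r r₀ h g α p ω θ M hρ hflat1 hr hflatx hr₀ hr₀r hα hhol hderiv hcontx heast hwest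
    hωn hω₁ hω₂ hwedge hdiv hflatreg
  have hopen : IsOpen D.carrier := D.isOpen
  -- `g = α⁻¹ h'` on the carrier
  have hg_eq : ∀ z ∈ D.carrier, g z = α⁻¹ * deriv h z := fun z hz => by
    rw [hderiv z hz]; field_simp
  have hg_ev : ∀ y, g =ᶠ[𝓝[D.carrier] y] fun z => α⁻¹ * deriv h z :=
    fun y => eventually_nhdsWithin_of_forall fun z hz => hg_eq z hz
  ----------------------------------------------------------------------------------------------
  -- clause 1: holomorphy of `g`
  ----------------------------------------------------------------------------------------------
  have hdh : DifferentiableOn ℂ (deriv h) D.carrier :=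
    ((hhol.analyticOnNhd hopen).deriv).differentiableOn
  have hg1 : DifferentiableOn ℂ g D.carrier :=
    (hdh.const_mul α⁻¹).congr fun z hz => hg_eq z hz
  refine ⟨hg1, ?_, ?_⟩
  ----------------------------------------------------------------------------------------------
  -- clause 2: the root
  ----------------------------------------------------------------------------------------------
  · -- local flatness at radius `r₀` and the filter identity
    have hflatx₀ : D.carrier ∩ ball x r₀ = {z : ℂ | x.im < z.im} ∩ ball x r₀ :=
      flat_of_subset hflatx rfl (ball_subset_ball hr₀r)
    have hfilt : 𝓝[D.carrier] x = 𝓝[{z : ℂ | x.im < z.im} ∩ ball x r₀] x :=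
      nhdsWithin_carrier_eq hr₀ hflatx₀
    set U : Set ℂ := {z : ℂ | x.im < z.im} ∩ ball x r₀ with hU
    have hUsub : U ⊆ D.carrier := fun z hz => by
      have : z ∈ D.carrier ∩ ball x r₀ := by rw [hflatx₀]; exact hz
      exact this.1
    have hUopen : IsOpen U := (isOpen_lt continuous_const continuous_im).inter isOpen_ball
    have hholU : DifferentiableOn ℂ h U := hhol.mono hUsub
    -- TwoArm: the straightened function `G`
    obtain ⟨G, hGd, hGform, hhG⟩ :=
      pickEngine_twoArmReflection x p θ r₀ h hr₀ hholU hcontx heast hwest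
    -- `G` is real on the east ray
    have hGreal : ∀ z ∈ ball x r₀, z.im = x.im → x.re < z.re → (G z).im = 0 := by
      intro z hz hzim hzre
      have hzx : z ≠ x := fun h0 => by rw [h0] at hzre; exact lt_irrefl _ hzre
      obtain ⟨s, hs⟩ := heast z hz hzim hzre
      have hmem : z ∈ ({z : ℂ | x.im ≤ z.im} ∩ ball x r₀) \ {x} := ⟨⟨le_of_eq hzim.symm, hz⟩, hzx⟩
      rw [hGform z hmem, hs, add_sub_cancel_left]
      have ht : z - x = (((z - x).re : ℝ) : ℂ) := Complex.ext (by simp) (by simp [hzim])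
      have htpos : 0 < (z - x).re := by simp; linarith
      rw [ht, show ((1 / 4 : ℂ)) = ((1 / 4 : ℝ) : ℂ) by push_cast; ring,
        ← ofReal_cpow htpos.le, ← mul_assoc, ← Complex.exp_add,
        show -((θ : ℂ) * I) + (θ : ℂ) * I = 0 by ring, Complex.exp_zero, one_mul]
      simp
    -- the wedge in straightened coordinates: `ω' = ω e^{-iθ}`, `M' = M + |re (ω̄ p)|`
    set ω' : ℂ := ω * exp (-((θ : ℂ) * I)) with hω'
    have hkey : ∀ z ∈ ({z : ℂ | x.im ≤ z.im} ∩ ball x r₀) \ {x},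
        (starRingEnd ℂ) ω' * ((z - x) ^ (-(1 / 4 : ℂ)) * G z) =
          (starRingEnd ℂ) ω * (h z - p) := by
      intro z hz
      have hzx : z - x ≠ 0 := sub_ne_zero.2 hz.2
      rw [hGform z hz]
      have h1 : (z - x) ^ (-(1 / 4 : ℂ)) * (z - x) ^ ((1 / 4 : ℂ)) = 1 := by
        rw [← cpow_add _ _ hzx, show -(1 / 4 : ℂ) + 1 / 4 = 0 by ring, cpow_zero]
      have h2 : (starRingEnd ℂ) ω' = (starRingEnd ℂ) ω * exp ((θ : ℂ) * I) := by
        rw [hω', map_mul, ← Complex.exp_conj]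
        congr 2
        simp [Complex.conj_ofReal]
      have h3 : exp ((θ : ℂ) * I) * exp (-((θ : ℂ) * I)) = 1 := by
        rw [← Complex.exp_add, show (θ : ℂ) * I + -((θ : ℂ) * I) = 0 by ring, Complex.exp_zero]
      calc (starRingEnd ℂ) ω' * ((z - x) ^ (-(1 / 4 : ℂ)) *
            (exp (-((θ : ℂ) * I)) * (h z - p) * (z - x) ^ ((1 / 4 : ℂ))))
          = (starRingEnd ℂ) ω * (exp ((θ : ℂ) * I) * exp (-((θ : ℂ) * I))) * (h z - p) *
              ((z - x) ^ (-(1 / 4 : ℂ)) * (z - x) ^ ((1 / 4 : ℂ))) := by rw [h2]; ring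
        _ = (starRingEnd ℂ) ω * (h z - p) := by rw [h1, h3]; ring
    have hwedge' : ∀ z ∈ ({z : ℂ | x.im ≤ z.im} ∩ ball x r₀) \ {x},
        -(M + |((starRingEnd ℂ) ω * p).re|) ≤
          ((starRingEnd ℂ) ω' * ((z - x) ^ (-(1 / 4 : ℂ)) * G z)).re := by
      intro z hz
      rw [hkey z hz, mul_sub, Complex.sub_re]
      have := hwedge z hz
      have := neg_abs_le ((starRingEnd ℂ) ω * p).re
      linarith [le_abs_self ((starRingEnd ℂ) ω * p).re]
    -- NoEssential: `G` is meromorphic at `x`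
    have hmer : MeromorphicAt G x :=
      pickEngine_noEssentialSingularity x ω' r₀ (M + |((starRingEnd ℂ) ω * p).re|) G hr₀ hω₁ hω₂
        hGd hGreal hwedge'
    -- RootOrder: removable singularity with nonzero value, and the coefficient
    have hω'n : ‖ω'‖ = 1 := by
      rw [hω', norm_mul, hωn, one_mul, show -((θ : ℂ) * I) = ((-θ : ℝ) : ℂ) * I by push_cast; ring,
        Complex.norm_exp_ofReal_mul_I]
    have hUx : U ⊆ {x}ᶜ := by
      rintro z ⟨hz, -⟩ rfl; simp at hz
    have hdivG : ∀ A : ℝ, ∃ᶠ z in 𝓝[U] x, A ≤ ‖(z - x) ^ (-(1 / 4 : ℂ)) * G z‖ := by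
      intro A
      have hfr : ∃ᶠ z in 𝓝[U] x, A + ‖p‖ ≤ ‖h z‖ := by rw [← hfilt]; exact hdiv (A + ‖p‖)
      refine (hfr.and_eventually self_mem_nhdsWithin).mono ?_
      rintro z ⟨hz, hzU⟩
      have hform := hhG z hzU
      have : (z - x) ^ (-(1 / 4 : ℂ)) * G z = exp (-((θ : ℂ) * I)) * (h z - p) := by
        rw [hform, ← mul_assoc, ← Complex.exp_add,
          show -((θ : ℂ) * I) + (θ : ℂ) * I = 0 by ring, Complex.exp_zero, one_mul]
      rw [this, norm_mul, show -((θ : ℂ) * I) = ((-θ : ℝ) : ℂ) * I by push_cast; ring,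
        Complex.norm_exp_ofReal_mul_I, one_mul]
      linarith [norm_sub_norm_le (h z) p, norm_sub_rev (h z) p,
        (norm_sub_le (h z) (h z - p) : ‖h z - (h z - p)‖ ≤ _), show ‖h z - (h z - p)‖ = ‖p‖ by simp]
    have hwedgeU : ∀ z ∈ U, -(M + |((starRingEnd ℂ) ω * p).re|) ≤
        ((starRingEnd ℂ) ω' * ((z - x) ^ (-(1 / 4 : ℂ)) * G z)).re :=
      fun z hz => hwedge' z ⟨⟨show x.im ≤ z.im from le_of_lt (show x.im < z.im from hz.1), hz.2⟩, hUx hz⟩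
    obtain ⟨c, hc, hGc, hcoef⟩ :=
      pickEngine_rootOrder x ω' r₀ (M + |((starRingEnd ℂ) ω * p).re|) G hr₀ hω'n hmer hwedgeU hdivG
    -- back to `g = α⁻¹ h'`, `h = p + e^{iθ} (· - x)^{-1/4} G` on `U`
    refine ⟨α⁻¹ * exp ((θ : ℂ) * I) * (-c / 4), by
      refine mul_ne_zero (mul_ne_zero (inv_ne_zero hα) (Complex.exp_ne_zero _)) ?_
      simpa using hc, ?_⟩
    have hderivU : ∀ z ∈ U, deriv h z =
        exp ((θ : ℂ) * I) * deriv (fun w => (w - x) ^ (-(1 / 4 : ℂ)) * G w) z := by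
      intro z hz
      have heq : h =ᶠ[𝓝 z] fun w => p + exp ((θ : ℂ) * I) * ((w - x) ^ (-(1 / 4 : ℂ)) * G w) := by
        filter_upwards [hUopen.mem_nhds hz] with w hw
        rw [← hhG w hw]; ring
      rw [heq.deriv_eq]
      have hzx : z - x ≠ 0 := sub_ne_zero.2 (hUx hz)
      have hslit : z - x ∈ slitPlane := mem_slitPlane_iff.2 (Or.inr (by
        have : 0 < (z - x).im := by simp only [sub_im, sub_pos]; exact hz.1
        exact this.ne'))
      have hGz : DifferentiableAt ℂ G z :=
        hGd.differentiableAt ((isOpen_ball.sdiff isClosed_singleton).mem_nhds ⟨hz.2, hUx hz⟩)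
      have hF : DifferentiableAt ℂ (fun w => (w - x) ^ (-(1 / 4 : ℂ)) * G w) z :=
        ((differentiableAt_id.sub_const x).cpow_const hslit).mul hGz
      rw [deriv_const_add, deriv_const_mul _ hF]
    have hlim := (hcoef.mono_left (nhdsWithin_mono x (inter_subset_left : U ⊆ {z : ℂ | x.im < z.im})))
    rw [hfilt]
    refine ((hlim.const_mul (α⁻¹ * exp ((θ : ℂ) * I)))).congr' ?_
    filter_upwards [self_mem_nhdsWithin] with z hz
    rw [hg_eq z (hUsub hz), hderivU z hz]
    ring
  ----------------------------------------------------------------------------------------------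
  -- clause 3: the flat points
  ----------------------------------------------------------------------------------------------
  · intro y hy hyx
    obtain ⟨ρ', hρ', θ', p', c', hc', hconty, hliney, hgrowy⟩ := hflatreg y hy hyx
    -- a radius inside the pinned ball at `y`
    obtain ⟨s, hs, hsρ', hflaty⟩ : ∃ s : ℝ, 0 < s ∧ s ≤ ρ' ∧
        D.carrier ∩ ball y s = {z : ℂ | y.im < z.im} ∩ ball y s := by
      rcases hy with ⟨hyim, hyb⟩ | ⟨hyim, hyb⟩
      · obtain ⟨s₁, hs₁, hsub⟩ := exists_ball_subset_ball hyb
        refine ⟨min s₁ ρ', lt_min hs₁ hρ', min_le_right _ _, ?_⟩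
        exact flat_of_subset hflat1 hyim ((ball_subset_ball (min_le_left _ _)).trans hsub)
      · obtain ⟨s₁, hs₁, hsub⟩ := exists_ball_subset_ball hyb
        refine ⟨min s₁ ρ', lt_min hs₁ hρ', min_le_right _ _, ?_⟩
        exact flat_of_subset hflatx hyim ((ball_subset_ball (min_le_left _ _)).trans hsub)
    have hVsub : {z : ℂ | y.im < z.im} ∩ ball y s ⊆ D.carrier := fun z hz => by
      have : z ∈ D.carrier ∩ ball y s := by rw [hflaty]; exact hz
      exact this.1
    have hholV : DifferentiableOn ℂ h ({z : ℂ | y.im < z.im} ∩ ball y s) := hhol.mono hVsub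
    have hcontV : ContinuousOn h ({z : ℂ | y.im ≤ z.im} ∩ ball y s) :=
      hconty.mono (inter_subset_inter_right _ (ball_subset_ball hsρ'))
    have hlineV : ∀ z ∈ ball y s, z.im = y.im →
        (exp (-((θ' : ℂ) * I)) * (h z - p')).im = 0 :=
      fun z hz hzim => hliney z (ball_subset_ball hsρ' hz) hzim
    have hgrowV : ∀ t : ℝ, 0 < t → t < s →
        c' * t ≤ |(exp (-((θ' : ℂ) * I)) * (h (y + (t : ℂ) * I) - p')).im| :=
      fun t ht hts => hgrowy t ht (hts.trans_le hsρ')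
    obtain ⟨w, hw, hlim⟩ := pickEngine_flatValue y p' θ' s c' h hs hc' hholV hcontV hlineV hgrowV
    refine ⟨α⁻¹ * w, mul_ne_zero (inv_ne_zero hα) hw, ?_⟩
    have hg_ev_y := hg_ev y
    rw [nhdsWithin_carrier_eq hs hflaty] at hg_ev_y ⊢
    exact ((hlim.const_mul α⁻¹)).congr' hg_ev_y.symm

end Summit.CriticalPhenomena.SAWScalingLimit.Theorems.PickHalfPlane.Engine

end
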